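import Summits.ResolutionOfSingularities.ResolutionOfSingularities.Theorems.FrobeniusClosingPatchingRelPerfectDepthWeightedStepBookkeeping
import Literature.AlgebraicGeometry.Hironaka2017.Lib.IrreducibleCentrePieces
import Literature.AlgebraicGeometry.Hironaka2017.Lib.MonomialPartBlowup
import Literature.AlgebraicGeometry.Resolution.MarkedIdealsArithmetic
import Literature.AlgebraicGeometry.Resolution.CoefficientIdealRestrictionPersistence
import HarnessLib

/-!
# Crux `PatchingRelPerfect` (stmt-ResolutionOfSingularities-16161), chain W5.2 — F7(β) «W-LIFT»: the MONOMIAL BOOKKEEPING of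
# one weighted step along an IRREDUCIBLE centre `W` NOT contained in a given boundary member (the cylinder centres
# `W̄ = closure (r′⁻¹(C))`, TRANSVERSAL to `E′`) — (L1)–(L3) of res-L1-w52-plan-1's STEER 2026-08-27T14:01:01Z

[OURS · L1 W5.2 · F7(β) X-side support · res-L1-w52-plan-1 RULING G10-3 (1) X-HAND ASK «the W-step lemma … generalises
`controlledTransform_host_mul_monomialIdeal` p514886 — res-D-pv-021 invited» + STEER 14:01:01Z «ONE bookkeeping file (L1)–(L3)
for an arbitrary regular centre W with W ×_X E′ = C (no `W ≤ E′` hypothesis anywhere; E′-exponent unchanged), THEN (L4)»;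
design memo `L/res-L1-w52-plan-1/F7BETA-DESIGN-MEMO-v2.md` 881c372da0356908 §3 / Q5.]  Replaces the role of NO printed item;
NOT a statement of the manuscript under review; fact-free.  AI-written; AI review is weaker than expert review.

THE POINT OF THIS FILE: the bookkeeping identity p514886 (`DepthTargets.controlledTransform_host_mul_monomialIdeal`) is
ALREADY stated for an ARBITRARY centre `C` on an arbitrary scheme — nothing in it asks `C ≤ E′` — and its incidence hypothesis
`UniformPieces ℬ C [V(C)]` ALLOWS boundary members TRANSVERSAL to the centre (second alternative of `UniformPieces`). For an
IRREDUCIBLE centre (generic point `η`) uniformity is automatic (`uniformPieces_single_of_isGenericPoint`, res-type-077's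
`Lib/IrreducibleCentrePieces`) and the piece weight is the weight AT `η` (`weightOf_divisorsOver_single_eq_weightAt`). Hence:

* `controlledTransform_host_mul_monomialIdeal_of_isGenericPoint` — **(L3) host side**: for a state `𝔟 = D · monomialIdeal ℬ` on
  `X`, a blowing up `τ : X′ → X` along `𝓘_W = vanishingIdeal W` (`W` irreducible closed, generic point `η`, snc with the boundary),
  host order `m` (`D ≤ 𝓘_W^m`) and weight `ν ≤ m + weightAt ℬ η`:
  `τᶜ(𝔟, ν) = τᶜ(D, m) · monomialIdeal (ℬ.map (st × id) ++ [(F, m + weightAt ℬ η − ν)])` — the new exceptional member carries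
  `m + w(η) − ν`, where `w(η) = Σ_{η ∈ B} e_B` counts ONLY the members CONTAINING `W`; `comap_host_mul_monomialIdeal_of_isGenericPoint`
  is the total-transform form `τ^*𝔟 = F^{m + w(η)} · (τᶜ(D,m) · monomialIdeal (ℬ.map st))`;
* `weightAt_cons_of_not_mem_support` / `comap_eq_strictTransformIdeal_of_not_mem_support` (and `…_mul_of_mem_support` for the
  members THROUGH `W`) — **(L3) «E′-exponent unchanged, no new E-component»**:
  a member `B ∈ boundaryOf ℬ` with `η ∉ V(B)` (e.g. `B = E′` for a centre `W ⊄ E′` with `W ∩ E′ = C`) contributes NOTHING to `w(η)`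
  (`weightAt (ℬ with B removed …)` — stated as: `weightAt ((B, e) :: ℬ) η = weightAt ℬ η`) and pulls back to its STRICT transform,
  `B.comap τ = strictTransformIdeal τ 𝓘_W B` (`Lib/MonomialPartBlowup.comap_eq_strictTransformIdeal` + the generic-point dichotomy);
* `comap_le_pow_of_isGenericPoint` — **(L1) legality, X-side half**: `D ≤ 𝓘_W^m ∧ ν ≤ m + w(η)` ⟹ `𝔟 ≤ 𝓘_W^ν` is NOT needed for the law
  (it follows on `X′`: `τ^*𝔟 ≤ F^ν`, `comap_le_pow_of_isGenericPoint`); the E-visible reading of `D ≤ 𝓘_W^m` / `η ∈ B` through the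
  retraction (plan-1 (L1)/(L2): `W̄ = closure r′⁻¹(C)`, `Bl_W V = Bl_C (E′ ∩ V) × 𝔸¹`) is res-D-pv-052's `retractLift` kit and is NOT
  in this file; (L4) (the pole points of `W̄ ∖ V`) is the genuinely new lemma and is NOT in this file.

## References
* E. Bierstone, D. Grigoriev, P. Milman, J. Włodarczyk, *Effective Hironaka resolution and its complexity*, Asian J. Math. 15 (2011),
  Def. 3.1.3 (4), §3.2 Lemma 3.2.1, §4 Step 2a. [BierstoneGrigorievMilmanWlodarczyk2011]
* J. Kollár, *Lectures on Resolution of Singularities* (2007), (3.111) Steps 1–3. [Kollar2007]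
-/

-- `Summit.<Summit>.<Sub>.Theorems` with `Sub = Summit` (single-conjunct summit, D-0017)
set_option linter.dupNamespace false

noncomputable section

open CategoryTheory AlgebraicGeometry TopologicalSpace
open Literature.AlgebraicGeometry.Resolution
open Literature.AlgebraicGeometry.Hironaka2017.MonomialPart
open Scheme.IdealSheafData

namespace Summit.ResolutionOfSingularities.ResolutionOfSingularities.Theorems.DepthCylinderCentre

universe u

variable {X X' : Scheme.{u}} {τ : X' ⟶ X} {W : Closeds X} {η : X} {ℬ : List (X.IdealSheafData × ℕ)}

/-! ## (L3) host side: the bookkeeping identity along an irreducible centre, weight counted AT the generic point -/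

/-- **Total transform of a state `𝔟 = D · monomialIdeal ℬ` along an IRREDUCIBLE centre** `𝓘_W` (generic point `η`, snc with the
boundary), host order `m`: `τ^*𝔟 = F^{m + w(η)} · (τᶜ(D, m) · monomialIdeal (ℬ.map st))`, `w(η) = weightAt ℬ η` = the total exponent
of the members CONTAINING `W` (the transversal ones contribute nothing). p514886's `comap_host_mul_monomialIdeal` with the
uniformity of the single piece `V(𝓘_W)` supplied by the generic point. [cite: Kollar2007, (3.111) Step 1]
[cite: BierstoneGrigorievMilmanWlodarczyk2011, §3.2 Lemma 3.2.1, §4 Step 2a] -/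
theorem comap_host_mul_monomialIdeal_of_isGenericPoint [IsLocallyNoetherian X] (hη : IsGenericPoint η (W : Set X))
    {𝔟 D : X.IdealSheafData} {m : ℕ} (h𝔟 : 𝔟 = D * monomialIdeal ℬ) (hD : D ≤ vanishingIdeal W ^ m)
    (hsnc : HasSNCWith (boundaryOf ℬ) (vanishingIdeal W)) (hτ : IsBlowup τ (vanishingIdeal W)) :
    𝔟.comap τ =
      (vanishingIdeal W).comap τ ^ (m + weightAt ℬ η) *
        (controlledTransform τ (vanishingIdeal W) D m *
          monomialIdeal (ℬ.map fun p => (strictTransformIdeal τ (vanishingIdeal W) p.1, p.2))) := by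
  rw [← weightOf_divisorsOver_single_eq_weightAt ℬ hη]
  exact DepthTargets.comap_host_mul_monomialIdeal h𝔟 hD hsnc (uniformPieces_single_of_isGenericPoint ℬ hη) hτ

/-- **THE W-STEP BOOKKEEPING LAW (L3, host side).** For a state `𝔟 = D · monomialIdeal ℬ` on `X`, a blowing up `τ : X′ → X` along
the ideal `𝓘_W` of an IRREDUCIBLE closed centre `W` (generic point `η`) having simple normal crossings with the boundary, host
order `m` (`D ≤ 𝓘_W^m`) and a weight `ν ≤ m + weightAt ℬ η`:
`τᶜ(𝔟, ν) = τᶜ(D, m) · monomialIdeal (ℬ.map (st × id) ++ [(F, m + weightAt ℬ η − ν)])`.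
NO hypothesis relates `W` to any particular member: members through `η` (`η ∈ V(B)`, i.e. `W ⊆ B`) are counted in `weightAt ℬ η`,
members with `η ∉ V(B)` — in particular a member `E′` met TRANSVERSALLY by `W` (`W ⊄ E′`, `W ∩ E′ = C`) — keep their exponent on
their strict transform and add nothing to the exceptional exponent («E′-exponent unchanged»). This is p514886 VERBATIM at
`C := 𝓘_W`, the uniform-pieces hypothesis discharged by the generic point. [cite: Kollar2007, (3.111) Steps 1–3]
[cite: BierstoneGrigorievMilmanWlodarczyk2011, Def. 3.1.3 (4), §4 Step 2a] -/
theorem controlledTransform_host_mul_monomialIdeal_of_isGenericPoint [IsLocallyNoetherian X]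
    (hη : IsGenericPoint η (W : Set X)) {𝔟 D : X.IdealSheafData} {m ν : ℕ} (h𝔟 : 𝔟 = D * monomialIdeal ℬ)
    (hD : D ≤ vanishingIdeal W ^ m) (hν : ν ≤ m + weightAt ℬ η)
    (hsnc : HasSNCWith (boundaryOf ℬ) (vanishingIdeal W)) (hτ : IsBlowup τ (vanishingIdeal W)) :
    controlledTransform τ (vanishingIdeal W) 𝔟 ν =
      controlledTransform τ (vanishingIdeal W) D m *
        monomialIdeal ((ℬ.map fun p => (strictTransformIdeal τ (vanishingIdeal W) p.1, p.2)) ++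
          [((vanishingIdeal W).comap τ, m + weightAt ℬ η - ν)]) := by
  have hν' : ν ≤ m + weightOf ℬ (divisorsOver ℬ (vanishingIdeal W) (vanishingIdeal W).support) := by
    rwa [weightOf_divisorsOver_single_eq_weightAt ℬ hη]
  rw [← weightOf_divisorsOver_single_eq_weightAt ℬ hη]
  exact DepthTargets.controlledTransform_host_mul_monomialIdeal h𝔟 hD hν' hsnc
    (uniformPieces_single_of_isGenericPoint ℬ hη) hτ

/-- The same law with the exceptional factor written separately: `τᶜ(𝔟, ν) = F^{m + w(η) − ν} · (τᶜ(D, m) · monomialIdeal (ℬ.map st))`.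
[cite: Kollar2007, (3.111) Steps 1–3] -/
theorem controlledTransform_host_mul_monomialIdeal_of_isGenericPoint' [IsLocallyNoetherian X]
    (hη : IsGenericPoint η (W : Set X)) {𝔟 D : X.IdealSheafData} {m ν : ℕ} (h𝔟 : 𝔟 = D * monomialIdeal ℬ)
    (hD : D ≤ vanishingIdeal W ^ m) (hν : ν ≤ m + weightAt ℬ η)
    (hsnc : HasSNCWith (boundaryOf ℬ) (vanishingIdeal W)) (hτ : IsBlowup τ (vanishingIdeal W)) :
    controlledTransform τ (vanishingIdeal W) 𝔟 ν =
      (vanishingIdeal W).comap τ ^ (m + weightAt ℬ η - ν) *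
        (controlledTransform τ (vanishingIdeal W) D m *
          monomialIdeal (ℬ.map fun p => (strictTransformIdeal τ (vanishingIdeal W) p.1, p.2))) := by
  rw [controlledTransform_host_mul_monomialIdeal_of_isGenericPoint hη h𝔟 hD hν hsnc hτ, monomialIdeal_append,
    monomialIdeal_singleton]
  ring

/-- **(L1), X-side half: the state IS divisible by `𝓘_W^ν` on `X′`** — `τ^*𝔟 ≤ F^ν` under the same split `ν ≤ m + weightAt ℬ η`
(no separate legality hypothesis `𝔟 ≤ 𝓘_W^ν` is ever needed by the law). [cite: Kollar2007, (3.111) Step 1] -/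
theorem comap_le_pow_of_isGenericPoint [IsLocallyNoetherian X] (hη : IsGenericPoint η (W : Set X))
    {𝔟 D : X.IdealSheafData} {m ν : ℕ} (h𝔟 : 𝔟 = D * monomialIdeal ℬ) (hD : D ≤ vanishingIdeal W ^ m)
    (hν : ν ≤ m + weightAt ℬ η) (hsnc : HasSNCWith (boundaryOf ℬ) (vanishingIdeal W)) (hτ : IsBlowup τ (vanishingIdeal W)) :
    𝔟.comap τ ≤ (vanishingIdeal W).comap τ ^ ν := by
  have hν' : ν ≤ m + weightOf ℬ (divisorsOver ℬ (vanishingIdeal W) (vanishingIdeal W).support) := by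
    rwa [weightOf_divisorsOver_single_eq_weightAt ℬ hη]
  exact DepthTargets.comap_host_mul_monomialIdeal_le_pow h𝔟 hD hν' hsnc (uniformPieces_single_of_isGenericPoint ℬ hη) hτ

/-! ## (L3) «E′-exponent unchanged, no new E-component»: members not containing the centre -/

/-- **A member not containing the centre adds nothing to the exceptional exponent**: if `η ∉ V(B)` then
`weightAt ((B, e) :: ℬ) η = weightAt ℬ η`. (For `B = E′` and a cylinder centre `W ⊄ E′`: the E′-exponent does not enter.)
[cite: Kollar2007, (3.111) Step 1] -/
theorem weightAt_cons_of_not_mem_support {B : X.IdealSheafData} (e : ℕ) (hηB : η ∉ B.support) :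
    weightAt ((B, e) :: ℬ) η = weightAt ℬ η :=
  weightAt_cons_of_not_mem ℬ hηB

/-- **A member not containing the irreducible centre pulls back to its STRICT transform** (no exceptional component):
if `η ∉ V(B)` for the generic point `η` of `W`, then `B.comap τ = strictTransformIdeal τ 𝓘_W B`. For `B = E′` and a cylinder
centre `W ⊄ E′` this is «`E″ =` the strict `=` the total transform of `E′`, no new E-component» of plan-1's (L2).
[cite: Kollar2007, (3.111) Step 1] -/
theorem comap_eq_strictTransformIdeal_of_not_mem_support [IsLocallyNoetherian X] (hη : IsGenericPoint η (W : Set X))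
    (hsnc : HasSNCWith (boundaryOf ℬ) (vanishingIdeal W)) (hτ : IsBlowup τ (vanishingIdeal W))
    {B : X.IdealSheafData} (hB : B ∈ boundaryOf ℬ) (hηB : η ∉ B.support) :
    B.comap τ = strictTransformIdeal τ (vanishingIdeal W) B := by
  refine comap_eq_strictTransformIdeal hsnc hτ hB fun x hx _ => ?_
  refine not_stalkIdeal_le_of_isGenericPoint_not_mem hη hηB ?_
  rwa [← Scheme.IdealSheafData.coe_support_vanishingIdeal W]

/-- **A member CONTAINING the irreducible centre pulls back to its strict transform TIMES the exceptional divisor**: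
if `η ∈ V(B)` then `B.comap τ = strictTransformIdeal τ 𝓘_W B · F`. (The N-charged members and the hosts through `W`.)
[cite: Kollar2007, (3.111) Step 1] -/
theorem comap_eq_strictTransformIdeal_mul_of_mem_support [IsLocallyNoetherian X] (hη : IsGenericPoint η (W : Set X))
    (hsnc : HasSNCWith (boundaryOf ℬ) (vanishingIdeal W)) (hτ : IsBlowup τ (vanishingIdeal W))
    {B : X.IdealSheafData} (hB : B ∈ boundaryOf ℬ) (hηB : η ∈ B.support) :
    B.comap τ = strictTransformIdeal τ (vanishingIdeal W) B * (vanishingIdeal W).comap τ :=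
  comap_eq_strictTransformIdeal_mul hsnc hτ hB (le_vanishingIdeal_of_isGenericPoint_mem hη hηB)

/-! ## The SUP format: several «host × monomial» summands along one centre (multi-host / pocket states) -/

/-- **W-step for a TWO-summand state** `𝔟₁ ⊔ 𝔟₂` (`𝔟ᵢ = Dᵢ · monomialIdeal ℬᵢ`, host orders `mᵢ`, one weight `ν ≤ mᵢ + w_i(η)`):
`τᶜ(𝔟₁ ⊔ 𝔟₂, ν) = τᶜ(D₁,m₁)·mono(ℬ₁.map st ++ [(F, m₁ + w₁(η) − ν)]) ⊔ τᶜ(D₂,m₂)·mono(ℬ₂.map st ++ [(F, m₂ + w₂(η) − ν)])`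
(BGMW Lemma 3.7.1 (1) `controlledTransform_sup` + the one-summand law; the summands may use different boundary lists over a
common ambient, e.g. a host part and an N-member part). [cite: BierstoneGrigorievMilmanWlodarczyk2011, Lemma 3.7.1 (1), §4 Step 2a] -/
theorem controlledTransform_sup_of_isGenericPoint [IsLocallyNoetherian X] (hη : IsGenericPoint η (W : Set X))
    {ℬ₁ ℬ₂ : List (X.IdealSheafData × ℕ)} {𝔟₁ 𝔟₂ D₁ D₂ : X.IdealSheafData} {m₁ m₂ ν : ℕ}
    (h₁ : 𝔟₁ = D₁ * monomialIdeal ℬ₁) (h₂ : 𝔟₂ = D₂ * monomialIdeal ℬ₂)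
    (hD₁ : D₁ ≤ vanishingIdeal W ^ m₁) (hD₂ : D₂ ≤ vanishingIdeal W ^ m₂)
    (hν₁ : ν ≤ m₁ + weightAt ℬ₁ η) (hν₂ : ν ≤ m₂ + weightAt ℬ₂ η)
    (hsnc₁ : HasSNCWith (boundaryOf ℬ₁) (vanishingIdeal W)) (hsnc₂ : HasSNCWith (boundaryOf ℬ₂) (vanishingIdeal W))
    (hτ : IsBlowup τ (vanishingIdeal W)) :
    controlledTransform τ (vanishingIdeal W) (𝔟₁ ⊔ 𝔟₂) ν =
      controlledTransform τ (vanishingIdeal W) D₁ m₁ *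
          monomialIdeal ((ℬ₁.map fun p => (strictTransformIdeal τ (vanishingIdeal W) p.1, p.2)) ++
            [((vanishingIdeal W).comap τ, m₁ + weightAt ℬ₁ η - ν)]) ⊔
        controlledTransform τ (vanishingIdeal W) D₂ m₂ *
          monomialIdeal ((ℬ₂.map fun p => (strictTransformIdeal τ (vanishingIdeal W) p.1, p.2)) ++
            [((vanishingIdeal W).comap τ, m₂ + weightAt ℬ₂ η - ν)]) := by
  haveI : IsProper τ := hτ.isProper
  haveI : IsLocallyNoetherian X' := LocallyOfFiniteType.isLocallyNoetherian τ
  rw [controlledTransform_sup hτ.isEffectiveCartier (comap_le_pow_of_isGenericPoint hη h₁ hD₁ hν₁ hsnc₁ hτ)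
      (comap_le_pow_of_isGenericPoint hη h₂ hD₂ hν₂ hsnc₂ hτ),
    controlledTransform_host_mul_monomialIdeal_of_isGenericPoint hη h₁ hD₁ hν₁ hsnc₁ hτ,
    controlledTransform_host_mul_monomialIdeal_of_isGenericPoint hη h₂ hD₂ hν₂ hsnc₂ hτ]

/-- **W-step for a FINITE SUP of «host × monomial» summands** `⨆_{i ∈ s} 𝔟ᵢ` with ONE weight `ν ≤ mᵢ + wᵢ(η)` for all `i`:
`τᶜ(⨆ᵢ 𝔟ᵢ, ν) = ⨆ᵢ τᶜ(Dᵢ, mᵢ) · monomialIdeal (ℬᵢ.map st ++ [(F, mᵢ + wᵢ(η) − ν)])` — the step law of a multi-host / monomial-SUM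
format along a cylinder centre (or at a pole), summand by summand. [cite: BierstoneGrigorievMilmanWlodarczyk2011, Lemma 3.7.1 (1), §4 Step 2a] -/
theorem controlledTransform_biSup_of_isGenericPoint [IsLocallyNoetherian X] (hη : IsGenericPoint η (W : Set X))
    {ι : Type*} (s : Finset ι) (ℬ : ι → List (X.IdealSheafData × ℕ)) (𝔟 D : ι → X.IdealSheafData) (m : ι → ℕ) {ν : ℕ}
    (h𝔟 : ∀ i ∈ s, 𝔟 i = D i * monomialIdeal (ℬ i)) (hD : ∀ i ∈ s, D i ≤ vanishingIdeal W ^ m i)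
    (hν : ∀ i ∈ s, ν ≤ m i + weightAt (ℬ i) η) (hsnc : ∀ i ∈ s, HasSNCWith (boundaryOf (ℬ i)) (vanishingIdeal W))
    (hτ : IsBlowup τ (vanishingIdeal W)) :
    controlledTransform τ (vanishingIdeal W) (⨆ i ∈ s, 𝔟 i) ν =
      ⨆ i ∈ s, controlledTransform τ (vanishingIdeal W) (D i) (m i) *
        monomialIdeal (((ℬ i).map fun p => (strictTransformIdeal τ (vanishingIdeal W) p.1, p.2)) ++
          [((vanishingIdeal W).comap τ, m i + weightAt (ℬ i) η - ν)]) := by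
  classical
  haveI : IsProper τ := hτ.isProper
  haveI : IsLocallyNoetherian X' := LocallyOfFiniteType.isLocallyNoetherian τ
  induction s using Finset.induction_on with
  | empty => simp [controlledTransform_bot hτ.isEffectiveCartier]
  | insert a s ha ih =>
    have h𝔟' : ∀ i ∈ s, 𝔟 i = D i * monomialIdeal (ℬ i) := fun i hi => h𝔟 i (Finset.mem_insert_of_mem hi)
    have hD' : ∀ i ∈ s, D i ≤ vanishingIdeal W ^ m i := fun i hi => hD i (Finset.mem_insert_of_mem hi)
    have hν' : ∀ i ∈ s, ν ≤ m i + weightAt (ℬ i) η := fun i hi => hν i (Finset.mem_insert_of_mem hi)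
    have hsnc' : ∀ i ∈ s, HasSNCWith (boundaryOf (ℬ i)) (vanishingIdeal W) :=
      fun i hi => hsnc i (Finset.mem_insert_of_mem hi)
    have ha' : a ∈ insert a s := Finset.mem_insert_self a s
    have hle : ∀ i ∈ insert a s, (𝔟 i).comap τ ≤ (vanishingIdeal W).comap τ ^ ν :=
      fun i hi => comap_le_pow_of_isGenericPoint hη (h𝔟 i hi) (hD i hi) (hν i hi) (hsnc i hi) hτ
    have hsup : (⨆ i ∈ s, 𝔟 i).comap τ ≤ (vanishingIdeal W).comap τ ^ ν := by
      rw [Scheme.IdealSheafData.comap_iSup]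
      refine iSup_le fun i => ?_
      rw [Scheme.IdealSheafData.comap_iSup]
      exact iSup_le fun hi => hle i (Finset.mem_insert_of_mem hi)
    rw [Finset.iSup_insert, Finset.iSup_insert, controlledTransform_sup hτ.isEffectiveCartier (hle a ha') hsup,
      controlledTransform_host_mul_monomialIdeal_of_isGenericPoint hη (h𝔟 a ha') (hD a ha') (hν a ha') (hsnc a ha') hτ,
      ih h𝔟' hD' hν' hsnc']

end Summit.ResolutionOfSingularities.ResolutionOfSingularities.Theorems.DepthCylinderCentre

end
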